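import Mathlib.Analysis.SumIntegralComparisons
import Mathlib.Analysis.SpecialFunctions.Integrals.Basic
import Mathlib.Analysis.SpecialFunctions.Pow.Real
import Mathlib.Topology.Algebra.InfiniteSum.Real
import HarnessLib

/-!
# Partial summation against linearly bounded partial sums: `Σ x_n n^{−σ}` from `Σ_{n<N} x_n ≤ A N`

Topic `Literature/NumberTheory/CubicFields` (support for the Bessel-free Landau theorem, [LDTT] §2.2 (eq:W_split):
"dividing the sums into dyadic intervals, bounding the contribution of each by (eq:supposition), and using
(eq:CZ_bound) to sum the results"). For a NONNEGATIVE sequence `x` whose partial sums are at most affine-linear,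
`Σ_{n<k} x_n ≤ A k + A₀`, and a nonnegative antitone weight `u`, summation by parts gives
`Σ_{n<N} x_n u_n ≤ A Σ_{n<N} u_n + A₀ u_0` (`sum_mul_le_of_partialSums_le`, proved by a one-line induction on the
defect `P(N) = A N + A₀ − Σ_{n<N} x_n ≥ 0`). With `u_n = n^{−σ}` and the integral test this yields the two bounds
used for the dual Dirichlet series `Σ_n |b_n| μ_n^{−s}` of Landau's method (where `B_ψ(Z) = δ̂₁ Z`, [LDTT]
(eq:CZ_bound) with `r = 1`):

* `sum_mul_rpow_neg_le` — for `0 < σ < 1`: `Σ_{1 ≤ n < N} x_n n^{−σ} ≤ A (2 + 1/(1−σ)) N^{1−σ}`;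
* `summable_mul_rpow_neg`, `tsum_tail_mul_rpow_neg_le` — for `σ > 1` the series `Σ x_n n^{−σ}` converges and its
  tails satisfy `Σ_{n ≥ N} x_n n^{−σ} ≤ A (2 + 1/(σ−1)) N^{1−σ}` (`N ≥ 1`).

Everything here is PROVED; no definitions, no named facts.

## References

* D. Lowry-Duda, T. Taniguchi, F. Thorne, *Uniform bounds for lattice point counting and partial sums of zeta
  functions*, Math. Z. 300 (2022) = arXiv:1710.02190, §2.1 (eq:supposition)–(eq:CZ_bound), §2.2 (eq:W_split).
  [LowrydudaTaniguchiThorne2017]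
-/

noncomputable section

open Real MeasureTheory intervalIntegral

namespace Literature.NumberTheory.CubicFields

namespace LandauSums

/-- **Summation by parts against affine-linearly bounded partial sums.** If `x, u ≥ 0`, `u` is antitone and
`Σ_{n<k} x_n ≤ A k + A₀` for all `k`, then `Σ_{n<N} x_n u_n ≤ A Σ_{n<N} u_n + A₀ u_0` — in the sharper inductive
form with the defect `(A N + A₀ − Σ_{n<N} x_n) u_N` subtracted.
[cite: LowrydudaTaniguchiThorne2017, §2.2 (eq:W_split) (summation of (eq:supposition) against monotone weights)] -/
theorem sum_mul_le_of_partialSums_le_aux {x u : ℕ → ℝ} {A A₀ : ℝ} (hx : ∀ n, 0 ≤ x n) (hu : ∀ n, 0 ≤ u n)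
    (hanti : ∀ n, u (n + 1) ≤ u n) (hS : ∀ k, ∑ n ∈ Finset.range k, x n ≤ A * k + A₀) (N : ℕ) :
    ∑ n ∈ Finset.range N, x n * u n ≤
      A * ∑ n ∈ Finset.range N, u n + A₀ * u 0 - (A * N + A₀ - ∑ n ∈ Finset.range N, x n) * u N := by
  induction N with
  | zero => simp
  | succ N ih =>
    rw [Finset.sum_range_succ, Finset.sum_range_succ, Finset.sum_range_succ]
    have hP : 0 ≤ A * (N + 1 : ℕ) + A₀ - (∑ n ∈ Finset.range N, x n + x N) := by
      have := hS (N + 1); rw [Finset.sum_range_succ] at this; linarith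
    have hmono := hanti N
    have hxN := hx N
    have huN := hu (N + 1)
    push_cast at hP ⊢
    nlinarith

/-- **`Σ_{n<N} x_n u_n ≤ A Σ_{n<N} u_n + A₀ u_0`** for `x, u ≥ 0`, `u` antitone, `Σ_{n<k} x_n ≤ A k + A₀` (all `k`).
[cite: LowrydudaTaniguchiThorne2017, §2.2 (eq:W_split)] -/
theorem sum_mul_le_of_partialSums_le {x u : ℕ → ℝ} {A A₀ : ℝ} (hx : ∀ n, 0 ≤ x n) (hu : ∀ n, 0 ≤ u n)
    (hanti : ∀ n, u (n + 1) ≤ u n) (hS : ∀ k, ∑ n ∈ Finset.range k, x n ≤ A * k + A₀) (N : ℕ) :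
    ∑ n ∈ Finset.range N, x n * u n ≤ A * ∑ n ∈ Finset.range N, u n + A₀ * u 0 := by
  have h := sum_mul_le_of_partialSums_le_aux hx hu hanti hS N
  have hP : 0 ≤ (A * N + A₀ - ∑ n ∈ Finset.range N, x n) * u N := mul_nonneg (by linarith [hS N]) (hu N)
  linarith

/-! ### The weights `n^{−σ}` -/

/-- `Σ_{1 ≤ n < N} n^{−σ} ≤ 1 + N^{1−σ}/(1 − σ)` for `0 < σ < 1`, `N ≥ 1` (integral test). [folklore] -/
theorem sum_Ico_rpow_neg_le {σ : ℝ} (hσ0 : 0 < σ) (hσ1 : σ < 1) {N : ℕ} (hN : 1 ≤ N) :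
    ∑ n ∈ Finset.Ico 1 N, (n : ℝ) ^ (-σ) ≤ 1 + (N : ℝ) ^ (1 - σ) / (1 - σ) := by
  have h1σ : 0 < 1 - σ := by linarith
  rcases Nat.lt_or_ge N 2 with hN2 | hN2
  · interval_cases N
    simp only [Finset.Ico_self, Finset.sum_empty]
    positivity
  -- `N = M + 2`, `Σ_{1 ≤ n < M+2} n^{−σ} = 1 + Σ_{i ∈ Ico 1 (M+1)} (i+1)^{−σ} ≤ 1 + ∫_1^{M+1} t^{−σ} dt`
  obtain ⟨M, rfl⟩ : ∃ M, N = M + 2 := ⟨N - 2, by omega⟩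
  have hanti : AntitoneOn (fun t : ℝ => t ^ (-σ)) (Set.Icc ((1 : ℕ) : ℝ) ((M + 1 : ℕ) : ℝ)) := by
    intro a ha b _ hab
    have ha0 : 0 < a := by have := ha.1; simp at this; linarith
    exact Real.rpow_le_rpow_of_nonpos ha0 hab (by linarith)
  have hsum := AntitoneOn.sum_le_integral_Ico (f := fun t : ℝ => t ^ (-σ)) (by omega : 1 ≤ M + 1) hanti
  have hre : ∑ i ∈ Finset.Ico 1 (M + 1), (((i + 1 : ℕ) : ℝ)) ^ (-σ) = ∑ n ∈ Finset.Ico 2 (M + 2), (n : ℝ) ^ (-σ) := by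
    rw [← Finset.sum_Ico_add' (fun n : ℕ => (n : ℝ) ^ (-σ)) 1 (M + 1) 1]
  have hint : ∫ t in ((1 : ℕ) : ℝ)..((M + 1 : ℕ) : ℝ), t ^ (-σ) ≤ ((M + 2 : ℕ) : ℝ) ^ (1 - σ) / (1 - σ) := by
    have hM1 : (1 : ℝ) ≤ ((M + 1 : ℕ) : ℝ) := by exact_mod_cast (show 1 ≤ M + 1 by omega)
    rw [Nat.cast_one, integral_rpow (Or.inr ⟨by linarith, by
      rw [Set.uIcc_of_le hM1]; exact fun h => by linarith [h.1]⟩)]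
    rw [show -σ + 1 = 1 - σ by ring, Real.one_rpow, div_le_div_iff_of_pos_right h1σ]
    have : ((M + 1 : ℕ) : ℝ) ^ (1 - σ) ≤ ((M + 2 : ℕ) : ℝ) ^ (1 - σ) :=
      Real.rpow_le_rpow (by positivity) (by push_cast; linarith) h1σ.le
    linarith
  rw [Finset.sum_eq_sum_Ico_succ_bot (by omega : 1 < M + 2), Nat.cast_one, Real.one_rpow, ← hre]
  have := hsum.trans hint
  linarith

/-- `Σ_{k<K} (N+k)^{−σ} ≤ N^{−σ} + N^{1−σ}/(σ − 1)` for `σ > 1`, `N ≥ 1` (integral test). [folklore] -/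
theorem sum_range_add_rpow_neg_le {σ : ℝ} (hσ : 1 < σ) {N : ℕ} (hN : 1 ≤ N) (K : ℕ) :
    ∑ k ∈ Finset.range K, ((N + k : ℕ) : ℝ) ^ (-σ) ≤ (N : ℝ) ^ (-σ) + (N : ℝ) ^ (1 - σ) / (σ - 1) := by
  have hNpos : (0 : ℝ) < N := by exact_mod_cast hN
  have hσ1 : 0 < σ - 1 := by linarith
  have hnn : 0 ≤ (N : ℝ) ^ (-σ) + (N : ℝ) ^ (1 - σ) / (σ - 1) :=
    add_nonneg (Real.rpow_nonneg hNpos.le _) (div_nonneg (Real.rpow_nonneg hNpos.le _) hσ1.le)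
  rcases Nat.eq_zero_or_pos K with rfl | hK
  · simpa using hnn
  obtain ⟨K', rfl⟩ : ∃ K', K = K' + 1 := ⟨K - 1, by omega⟩
  have hanti : AntitoneOn (fun t : ℝ => t ^ (-σ)) (Set.Icc (N : ℝ) ((N : ℝ) + K')) := by
    intro a ha b _ hab
    exact Real.rpow_le_rpow_of_nonpos (by linarith [ha.1]) hab (by linarith)
  have hsum := AntitoneOn.sum_le_integral (f := fun t : ℝ => t ^ (-σ)) (x₀ := (N : ℝ)) (a := K') hanti
  have hint : ∫ t in (N : ℝ)..(N : ℝ) + K', t ^ (-σ) ≤ (N : ℝ) ^ (1 - σ) / (σ - 1) := by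
    rw [integral_rpow (Or.inr ⟨by linarith, by
      rw [Set.uIcc_of_le (by simp)]; exact fun h => by linarith [h.1]⟩)]
    have hM : 0 ≤ ((N : ℝ) + K') ^ (-σ + 1) := by positivity
    have hrhs : (N : ℝ) ^ (1 - σ) / (σ - 1) = (-(N : ℝ) ^ (-σ + 1)) / (-σ + 1) := by
      rw [show (1 : ℝ) - σ = -σ + 1 by ring, show σ - 1 = -(-σ + 1) by ring, div_neg, neg_div]
    rw [hrhs]
    exact div_le_div_of_nonpos_of_le (by linarith) (by linarith)
  have hsplit : ∑ k ∈ Finset.range (K' + 1), ((N + k : ℕ) : ℝ) ^ (-σ) =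
      ∑ i ∈ Finset.range K', ((N : ℝ) + ((i + 1 : ℕ) : ℝ)) ^ (-σ) + (N : ℝ) ^ (-σ) := by
    rw [Finset.sum_range_succ']
    congr 1
    refine Finset.sum_congr rfl fun i _ => ?_
    push_cast; ring_nf
  rw [hsplit]
  linarith

/-! ### The two bounds -/

/-- **`Σ_{1 ≤ n < N} x_n n^{−σ} ≤ A (2 + 1/(1 − σ)) N^{1−σ}`** for `0 < σ < 1`, `N ≥ 1`, when `x ≥ 0` has partial sums
`Σ_{n<k} x_n ≤ A k`. [cite: LowrydudaTaniguchiThorne2017, §2.2 (eq:W_split), first sum (μ_n ≤ z)] -/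
theorem sum_mul_rpow_neg_le {x : ℕ → ℝ} {A : ℝ} (hx : ∀ n, 0 ≤ x n) (hS : ∀ k, ∑ n ∈ Finset.range k, x n ≤ A * k)
    {σ : ℝ} (hσ0 : 0 < σ) (hσ1 : σ < 1) {N : ℕ} (hN : 1 ≤ N) :
    ∑ n ∈ Finset.Ico 1 N, x n * (n : ℝ) ^ (-σ) ≤ A * (2 + 1 / (1 - σ)) * (N : ℝ) ^ (1 - σ) := by
  have hA : 0 ≤ A := by have := hS 1; simp at this; linarith [hx 0]
  -- the antitone weight `u n = (max n 1)^{−σ}` (`= n^{−σ}` for `n ≥ 1`, `u 0 = 1`)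
  have hu0 : ∀ n : ℕ, 0 ≤ ((max n 1 : ℕ) : ℝ) ^ (-σ) := fun n => by positivity
  have hanti : ∀ n : ℕ, ((max (n + 1) 1 : ℕ) : ℝ) ^ (-σ) ≤ ((max n 1 : ℕ) : ℝ) ^ (-σ) := fun n =>
    Real.rpow_le_rpow_of_nonpos (by positivity) (by exact_mod_cast (by omega : max n 1 ≤ max (n + 1) 1))
      (by linarith)
  have h := sum_mul_le_of_partialSums_le (u := fun n => ((max n 1 : ℕ) : ℝ) ^ (-σ)) (A₀ := 0) hx hu0 hanti
    (fun k => by rw [add_zero]; exact hS k) N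
  have hIco : ∀ n ∈ Finset.Ico 1 N, ((max n 1 : ℕ) : ℝ) ^ (-σ) = (n : ℝ) ^ (-σ) := fun n hn => by
    rw [max_eq_left (Finset.mem_Ico.mp hn).1]
  rw [Finset.range_eq_Ico, Finset.sum_eq_sum_Ico_succ_bot (by omega : 0 < N),
    Finset.sum_eq_sum_Ico_succ_bot (by omega : 0 < N), zero_add] at h
  simp only [zero_le, max_eq_right, Nat.cast_one, Real.one_rpow, mul_one, add_zero] at h
  rw [Finset.sum_congr rfl fun n hn => by rw [hIco n hn], Finset.sum_congr rfl hIco] at h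
  have hw := sum_Ico_rpow_neg_le hσ0 hσ1 hN
  have hN1 : (1 : ℝ) ≤ (N : ℝ) ^ (1 - σ) := Real.one_le_rpow (by exact_mod_cast hN) (by linarith)
  have h1σ : 0 < 1 - σ := by linarith
  have hx0 := hx 0
  calc ∑ n ∈ Finset.Ico 1 N, x n * (n : ℝ) ^ (-σ) ≤ A * (1 + ∑ n ∈ Finset.Ico 1 N, (n : ℝ) ^ (-σ)) := by linarith
    _ ≤ A * (1 + (1 + (N : ℝ) ^ (1 - σ) / (1 - σ))) := by gcongr
    _ ≤ A * (2 + 1 / (1 - σ)) * (N : ℝ) ^ (1 - σ) := by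
        rw [mul_assoc]
        refine mul_le_mul_of_nonneg_left ?_ hA
        rw [add_mul, div_mul_eq_mul_div, one_mul]
        nlinarith

/-- **The shifted partial sums are bounded: `Σ_{k<K} x_{N+k} (N+k)^{−σ} ≤ A (2 + 1/(σ − 1)) N^{1−σ}`** (`σ > 1`,
`N ≥ 1`), when `x ≥ 0` has partial sums `Σ_{n<k} x_n ≤ A k`.
[cite: LowrydudaTaniguchiThorne2017, §2.2 (eq:W_split), second sum (μ_n > z)] -/
theorem sum_range_shift_mul_rpow_neg_le {x : ℕ → ℝ} {A : ℝ} (hx : ∀ n, 0 ≤ x n)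
    (hS : ∀ k, ∑ n ∈ Finset.range k, x n ≤ A * k) {σ : ℝ} (hσ : 1 < σ) {N : ℕ} (hN : 1 ≤ N) (K : ℕ) :
    ∑ k ∈ Finset.range K, x (N + k) * ((N + k : ℕ) : ℝ) ^ (-σ) ≤ A * (2 + 1 / (σ - 1)) * (N : ℝ) ^ (1 - σ) := by
  have hNpos : (0 : ℝ) < N := by exact_mod_cast hN
  have hσ1 : 0 < σ - 1 := by linarith
  have hu0 : ∀ k : ℕ, 0 ≤ ((N + k : ℕ) : ℝ) ^ (-σ) := fun k => by positivity
  have hanti : ∀ k : ℕ, ((N + (k + 1) : ℕ) : ℝ) ^ (-σ) ≤ ((N + k : ℕ) : ℝ) ^ (-σ) := fun k =>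
    Real.rpow_le_rpow_of_nonpos (by positivity) (by push_cast; linarith) (by linarith)
  -- shifted partial sums: `Σ_{j<k} x_{N+j} = S(N+k) − S(N) ≤ A k + A N`
  have hS' : ∀ k, ∑ j ∈ Finset.range k, x (N + j) ≤ A * k + A * N := by
    intro k
    have h1 : ∑ j ∈ Finset.range k, x (N + j) = ∑ n ∈ Finset.range (N + k), x n - ∑ n ∈ Finset.range N, x n := by
      rw [Finset.sum_range_add]; ring
    rw [h1]
    have := hS (N + k)
    have h0 : 0 ≤ ∑ n ∈ Finset.range N, x n := Finset.sum_nonneg fun n _ => hx n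
    push_cast at this
    linarith
  have h := sum_mul_le_of_partialSums_le (x := fun k => x (N + k)) (u := fun k => ((N + k : ℕ) : ℝ) ^ (-σ))
    (fun k => hx _) hu0 hanti hS' K
  have hw := sum_range_add_rpow_neg_le hσ hN K
  have hNσ : (N : ℝ) ^ (-σ) ≤ (N : ℝ) ^ (1 - σ) :=
    Real.rpow_le_rpow_of_exponent_le (by exact_mod_cast hN) (by linarith)
  have hNN : (N : ℝ) * (N : ℝ) ^ (-σ) = (N : ℝ) ^ (1 - σ) := by
    rw [show (1 : ℝ) - σ = 1 + -σ by ring, Real.rpow_add hNpos, Real.rpow_one]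
  simp only [add_zero] at h
  calc ∑ k ∈ Finset.range K, x (N + k) * ((N + k : ℕ) : ℝ) ^ (-σ)
      ≤ A * ∑ k ∈ Finset.range K, ((N + k : ℕ) : ℝ) ^ (-σ) + A * N * (N : ℝ) ^ (-σ) := by simpa using h
    _ ≤ A * ((N : ℝ) ^ (-σ) + (N : ℝ) ^ (1 - σ) / (σ - 1)) + A * (N : ℝ) ^ (1 - σ) := by
        have hA : 0 ≤ A := by have := hS 1; simp at this; linarith [hx 0]
        rw [mul_assoc A (N : ℝ), hNN]; gcongr
    _ ≤ A * ((N : ℝ) ^ (1 - σ) + (N : ℝ) ^ (1 - σ) / (σ - 1)) + A * (N : ℝ) ^ (1 - σ) := by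
        have hA : 0 ≤ A := by have := hS 1; simp at this; linarith [hx 0]
        gcongr
    _ = A * (2 + 1 / (σ - 1)) * (N : ℝ) ^ (1 - σ) := by ring

/-- **Summability for `σ > 1`** of `Σ x_n n^{−σ}` when `x ≥ 0` has partial sums `Σ_{n<k} x_n ≤ A k`. [folklore] -/
theorem summable_mul_rpow_neg {x : ℕ → ℝ} {A : ℝ} (hx : ∀ n, 0 ≤ x n) (hS : ∀ k, ∑ n ∈ Finset.range k, x n ≤ A * k)
    {σ : ℝ} (hσ : 1 < σ) : Summable fun n : ℕ => x n * (n : ℝ) ^ (-σ) := by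
  have h := sum_range_shift_mul_rpow_neg_le hx hS hσ (le_refl 1)
  have hs : Summable fun k : ℕ => x (1 + k) * ((1 + k : ℕ) : ℝ) ^ (-σ) :=
    summable_of_sum_range_le (fun k => mul_nonneg (hx _) (by positivity)) h
  have e : (fun k : ℕ => x (1 + k) * ((1 + k : ℕ) : ℝ) ^ (-σ)) = fun k => x (k + 1) * ((k + 1 : ℕ) : ℝ) ^ (-σ) := by
    funext k; rw [Nat.add_comm]
  rw [e] at hs
  exact (summable_nat_add_iff 1).mp hs

/-- Summability of the shifted tail. [folklore] -/
theorem summable_shift_mul_rpow_neg {x : ℕ → ℝ} {A : ℝ} (hx : ∀ n, 0 ≤ x n)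
    (hS : ∀ k, ∑ n ∈ Finset.range k, x n ≤ A * k) {σ : ℝ} (hσ : 1 < σ) (N : ℕ) :
    Summable fun k : ℕ => x (N + k) * ((N + k : ℕ) : ℝ) ^ (-σ) := by
  have h := (summable_nat_add_iff N).mpr (summable_mul_rpow_neg hx hS hσ)
  have e : (fun k : ℕ => x (k + N) * ((k + N : ℕ) : ℝ) ^ (-σ)) = fun k => x (N + k) * ((N + k : ℕ) : ℝ) ^ (-σ) := by
    funext k; rw [Nat.add_comm]
  rw [← e]
  exact h

/-- **The tail bound `Σ_{k ≥ 0} x_{N+k} (N+k)^{−σ} ≤ A (2 + 1/(σ − 1)) N^{1−σ}`** (`σ > 1`, `N ≥ 1`).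
[cite: LowrydudaTaniguchiThorne2017, §2.2 (eq:W_split)–(eq:Wp_semifinal) (the sum over μ_n > z)] -/
theorem tsum_shift_mul_rpow_neg_le {x : ℕ → ℝ} {A : ℝ} (hx : ∀ n, 0 ≤ x n)
    (hS : ∀ k, ∑ n ∈ Finset.range k, x n ≤ A * k) {σ : ℝ} (hσ : 1 < σ) {N : ℕ} (hN : 1 ≤ N) :
    ∑' k : ℕ, x (N + k) * ((N + k : ℕ) : ℝ) ^ (-σ) ≤ A * (2 + 1 / (σ - 1)) * (N : ℝ) ^ (1 - σ) :=
  Real.tsum_le_of_sum_range_le (fun k => mul_nonneg (hx _) (by positivity))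
    (sum_range_shift_mul_rpow_neg_le hx hS hσ hN)

end LandauSums

end Literature.NumberTheory.CubicFields

end
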